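import Literature.Probability.Percolation.QuadSubquadThickeningFourArcs
import Literature.Probability.Percolation.QuadCrossingQuadTopology
import HarnessLib

/-!
# The two closed Jordan domains above and below a crossing arc of the square

Topic `Probability/Percolation`; second plumbing file for the sub-quad thickening lemma
(`QuadSubquadThickening.lean`).  In the model square `S = [-1,1]²` let `α` be a simple arc from a
point `a` of the left side to a point `b` of the right side, meeting these sides only at `a`, `b`
(it may touch the top and bottom sides).  Closing `α` up through the points `±1 + 3i` above, and
through `±1 - 3i` below, gives two Jordan curves; `exists_halves` reads their closed Jordan
domains as two quads `Q⁺`, `Q⁻ ∈ 𝒬_ℂ` (`exists_quad_of_four_arcs`) such that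

* the bottom side of `Q⁺` and the top side of `Q⁻` are `α`, with the SAME parametrisation
  `Q⁺(x, 0) = Q⁻(x, 1)` (the Schoenflies parametrisations are matched along `α` by a
  self-homeomorphism of `[0,1]`);
* the left/right sides of both lie on the lines `re = ∓1`;
* `[Q⁺] ⊆ {-1 ≤ re ≤ 1, -1 ≤ im}`, `[Q⁻] ⊆ {-1 ≤ re ≤ 1, im ≤ 1}` (a closed Jordan domain lies in
  any closed box containing its curve, `closure_ofLoop_subset_reProdIm`);
* `[Q⁺] ∩ [Q⁻] ⊆ α` (`closure_ofLoop_inter_closure_ofLoop_subset`: below height `-1` one is off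
  the upper curve but inside points of the lower domain occur, and symmetrically).

The thickening lemma then cuts a thin band around `α` out of `[Q⁺] ∪ [Q⁻]`.  Everything is proved;
no named fact is introduced.

## References

* O. Schramm, S. Smirnov, *On the scaling limits of planar percolation*, Ann. Probab. 39 (2011),
  §1.3. [SchrammSmirnov2011]
-/

noncomputable section

open scoped unitInterval
open Set Metric Bornology Function
open Literature.Topology.PlaneTopology
open Literature.Probability.RandomPlanarGeometry

namespace Literature.Probability.Percolation

namespace QuadCrossing

namespace Quad

variable {D : Set ℂ}

/-- The bottom side as the range of `x ↦ Q(x, 0)`. [folklore] -/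
theorem side_one_eq_range (Q : Quad D) : Q.side 1 = range fun x : I => Q (x, 0) := by
  rw [side_one_eq]
  ext z
  constructor
  · rintro ⟨p, hp, rfl⟩
    refine ⟨p.1, ?_⟩
    show Q (p.1, 0) = Q p
    rw [show ((p.1, 0) : I × I) = p from Prod.ext rfl (by simpa using (Eq.symm hp))]
  · rintro ⟨x, rfl⟩
    exact ⟨(x, 0), rfl, rfl⟩

/-- The top side as the range of `x ↦ Q(x, 1)`. [folklore] -/
theorem side_three_eq_range (Q : Quad D) : Q.side 3 = range fun x : I => Q (x, 1) := by
  rw [side_three_eq]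
  ext z
  constructor
  · rintro ⟨p, hp, rfl⟩
    refine ⟨p.1, ?_⟩
    show Q (p.1, 1) = Q p
    rw [show ((p.1, 1) : I × I) = p from Prod.ext rfl (by simpa using (Eq.symm hp))]
  · rintro ⟨x, rfl⟩
    exact ⟨(x, 1), rfl, rfl⟩

/-- `Q(0, y)` lies on the left side. [folklore] -/
theorem apply_zero_mem_side_zero (Q : Quad D) (y : I) : Q (0, y) ∈ Q.side 0 := by
  rw [side_zero_eq]; exact ⟨(0, y), rfl, rfl⟩

/-- `Q(1, y)` lies on the right side. [folklore] -/
theorem apply_one_mem_side_two (Q : Quad D) (y : I) : Q (1, y) ∈ Q.side 2 := by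
  rw [side_two_eq]; exact ⟨(1, y), rfl, rfl⟩

end Quad

/-! ### Vertical and horizontal segments -/

/-- Points of a vertical segment: common real part, imaginary part in the unordered interval of
those of the ends. [folklore] -/
theorem mem_uIcc_im_of_mem_segment {p q z : ℂ} (hre : p.re = q.re) (hz : z ∈ segment ℝ p q) :
    z.re = p.re ∧ z.im ∈ uIcc p.im q.im := by
  rcases le_total p.im q.im with h | h
  · obtain ⟨h1, h2⟩ := (mem_segment_iff_of_re_eq h hre).1 hz
    exact ⟨h1, by rw [uIcc_of_le h]; exact h2⟩
  · rw [segment_symm] at hz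
    obtain ⟨h1, h2⟩ := (mem_segment_iff_of_re_eq h hre.symm).1 hz
    exact ⟨h1.trans hre.symm, by rw [uIcc_of_ge h]; exact h2⟩

/-- Points of a horizontal segment: common imaginary part, real part in the unordered interval of
those of the ends. [folklore] -/
theorem mem_uIcc_re_of_mem_segment {p q z : ℂ} (him : p.im = q.im) (hz : z ∈ segment ℝ p q) :
    z.im = p.im ∧ z.re ∈ uIcc p.re q.re := by
  rcases le_total p.re q.re with h | h
  · obtain ⟨h1, h2⟩ := (mem_segment_iff_of_im_eq h him).1 hz
    exact ⟨h1, by rw [uIcc_of_le h]; exact h2⟩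
  · rw [segment_symm] at hz
    obtain ⟨h1, h2⟩ := (mem_segment_iff_of_im_eq h him.symm).1 hz
    exact ⟨h1.trans him.symm, by rw [uIcc_of_ge h]; exact h2⟩

/-! ### The two halves -/

/-- **The closed Jordan domains above and below a crossing arc of the square, as quads glued
along the arc.**  For a simple arc `α ⊆ [-1,1]²` from `a` (`re a = -1`) to `b` (`re b = 1`)
meeting the lines `re = ∓1` only at `a`, `b`, there are quads `Q⁺, Q⁻ ∈ 𝒬_ℂ` with
`Q⁺(x,0) = Q⁻(x,1)` parametrising `α`, left/right sides on `re = ∓1`,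
`[Q⁺] ⊆ {-1 ≤ re ≤ 1, -1 ≤ im}`, `[Q⁻] ⊆ {-1 ≤ re ≤ 1, im ≤ 1}` and `[Q⁺] ∩ [Q⁻] ⊆ α`.
[cite: SchrammSmirnov2011, §1.3 (quads)] -/
theorem exists_halves {α : Set ℂ} {a b : ℂ} (hα : IsSimpleArc α a b)
    (hαS : α ⊆ Icc (-1 : ℝ) 1 ×ℂ Icc (-1 : ℝ) 1) (ha : a.re = -1) (hb : b.re = 1)
    (hαa : ∀ z ∈ α, z.re = -1 → z = a) (hαb : ∀ z ∈ α, z.re = 1 → z = b) :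
    ∃ QU QD : Quad (univ : Set ℂ),
      (∀ x : I, QU (x, 0) = QD (x, 1)) ∧ (range fun x : I => QU (x, 0)) = α ∧
      QU.side 0 ⊆ {z | z.re = -1} ∧ QU.side 2 ⊆ {z | z.re = 1} ∧
      QD.side 0 ⊆ {z | z.re = -1} ∧ QD.side 2 ⊆ {z | z.re = 1} ∧
      QU.carrier ⊆ {z | -1 ≤ z.re ∧ z.re ≤ 1 ∧ -1 ≤ z.im} ∧
      QD.carrier ⊆ {z | -1 ≤ z.re ∧ z.re ≤ 1 ∧ z.im ≤ 1} ∧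
      QU.carrier ∩ QD.carrier ⊆ α := by
  -- the four auxiliary corners
  set aU : ℂ := ⟨-1, 3⟩ with haU
  set bU : ℂ := ⟨1, 3⟩ with hbU
  set aD : ℂ := ⟨-1, -3⟩ with haD
  set bD : ℂ := ⟨1, -3⟩ with hbD
  have haα : a ∈ α := hα.left_mem
  have hbα : b ∈ α := hα.right_mem
  have hαre : ∀ z ∈ α, -1 ≤ z.re ∧ z.re ≤ 1 := fun z hz => (hαS hz).1
  have hαim : ∀ z ∈ α, -1 ≤ z.im ∧ z.im ≤ 1 := fun z hz => (hαS hz).2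
  obtain ⟨haim1, haim2⟩ := hαim a haα
  obtain ⟨hbim1, hbim2⟩ := hαim b hbα
  -- the six segments
  have sbbU : ∀ z ∈ segment ℝ b bU, z.re = 1 ∧ b.im ≤ z.im ∧ z.im ≤ 3 := fun z hz => by
    obtain ⟨h1, h2⟩ := mem_uIcc_im_of_mem_segment (p := b) (q := bU) (by rw [hb]) hz
    rw [uIcc_of_le (by show b.im ≤ 3; linarith)] at h2
    exact ⟨h1.trans hb, h2.1, h2.2⟩
  have sbUaU : ∀ z ∈ segment ℝ bU aU, z.im = 3 ∧ -1 ≤ z.re ∧ z.re ≤ 1 := fun z hz => by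
    obtain ⟨h1, h2⟩ := mem_uIcc_re_of_mem_segment (p := bU) (q := aU) rfl hz
    rw [uIcc_of_ge (by show (-1 : ℝ) ≤ 1; norm_num)] at h2
    exact ⟨h1, h2.1, h2.2⟩
  have saUa : ∀ z ∈ segment ℝ aU a, z.re = -1 ∧ a.im ≤ z.im ∧ z.im ≤ 3 := fun z hz => by
    obtain ⟨h1, h2⟩ := mem_uIcc_im_of_mem_segment (p := aU) (q := a) (by rw [ha]) hz
    rw [uIcc_of_ge (by show a.im ≤ 3; linarith)] at h2
    exact ⟨h1, h2.1, h2.2⟩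
  have saDbD : ∀ z ∈ segment ℝ aD bD, z.im = -3 ∧ -1 ≤ z.re ∧ z.re ≤ 1 := fun z hz => by
    obtain ⟨h1, h2⟩ := mem_uIcc_re_of_mem_segment (p := aD) (q := bD) rfl hz
    rw [uIcc_of_le (by show (-1 : ℝ) ≤ 1; norm_num)] at h2
    exact ⟨h1, h2.1, h2.2⟩
  have sbDb : ∀ z ∈ segment ℝ bD b, z.re = 1 ∧ -3 ≤ z.im ∧ z.im ≤ b.im := fun z hz => by
    obtain ⟨h1, h2⟩ := mem_uIcc_im_of_mem_segment (p := bD) (q := b) (by rw [hb]) hz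
    rw [uIcc_of_le (by show (-3 : ℝ) ≤ b.im; linarith)] at h2
    exact ⟨h1, h2.1, h2.2⟩
  have saaD : ∀ z ∈ segment ℝ a aD, z.re = -1 ∧ -3 ≤ z.im ∧ z.im ≤ a.im := fun z hz => by
    obtain ⟨h1, h2⟩ := mem_uIcc_im_of_mem_segment (p := a) (q := aD) (by rw [ha]) hz
    rw [uIcc_of_ge (by show (-3 : ℝ) ≤ a.im; linarith)] at h2
    exact ⟨h1.trans ha, h2.1, h2.2⟩
  have hb_ne : b ≠ bU := fun h => by have := congrArg Complex.im h; simp [hbU] at this; linarith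
  have hbUaU_ne : bU ≠ aU := fun h => by have := congrArg Complex.re h; norm_num [haU, hbU] at this
  have haUa_ne : aU ≠ a := fun h => by have := congrArg Complex.im h; simp [haU] at this; linarith
  have haDbD_ne : aD ≠ bD := fun h => by have := congrArg Complex.re h; norm_num [haD, hbD] at this
  have hbDb_ne : bD ≠ b := fun h => by have := congrArg Complex.im h; simp [hbD] at this; linarith
  have haaD_ne : a ≠ aD := fun h => by have := congrArg Complex.im h; simp [haD] at this; linarith
  -- the upper quad
  obtain ⟨γU, hγU, hpU, hiU, QU, hrU, hcU, hU0, hU1, hU2, hU3⟩ :=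
    exists_quad_of_four_arcs hα (IsSimpleArc.segment hb_ne) (IsSimpleArc.segment hbUaU_ne)
      (IsSimpleArc.segment haUa_ne)
      (fun z ⟨hz1, hz2⟩ => hαb z hz1 (sbbU z hz2).1)
      (fun z ⟨hz1, hz2⟩ => by
        obtain ⟨h1, -, -⟩ := sbbU z hz1
        obtain ⟨h2, -, -⟩ := sbUaU z hz2
        exact Complex.ext (by simp [hbU, h1]) (by simp [hbU, h2]))
      (fun z ⟨hz1, hz2⟩ => by
        obtain ⟨h1, -, -⟩ := sbUaU z hz1
        obtain ⟨h2, -, -⟩ := saUa z hz2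
        exact Complex.ext (by simp [haU, h2]) (by simp [haU, h1]))
      (fun z ⟨hz1, hz2⟩ => hαa z hz2 (saUa z hz1).1)
      (Set.disjoint_left.2 fun z hz1 hz2 => by
        have h1 := (hαim z hz1).2
        have h2 := (sbUaU z hz2).1
        linarith)
      (Set.disjoint_left.2 fun z hz1 hz2 => by
        have h1 := (sbbU z hz1).1
        have h2 := (saUa z hz2).1
        linarith)
  -- the lower quad
  obtain ⟨γD, hγD, hpD, hiD, QD, hrD, hcD, hD0, hD1, hD2, hD3⟩ :=
    exists_quad_of_four_arcs (IsSimpleArc.segment haDbD_ne) (IsSimpleArc.segment hbDb_ne) hα.symm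
      (IsSimpleArc.segment haaD_ne)
      (fun z ⟨hz1, hz2⟩ => by
        obtain ⟨h1, -, -⟩ := saDbD z hz1
        obtain ⟨h2, -, -⟩ := sbDb z hz2
        exact Complex.ext (by simp [hbD, h2]) (by simp [hbD, h1]))
      (fun z ⟨hz1, hz2⟩ => hαb z hz2 (sbDb z hz1).1)
      (fun z ⟨hz1, hz2⟩ => hαa z hz1 (saaD z hz2).1)
      (fun z ⟨hz1, hz2⟩ => by
        obtain ⟨h1, -, -⟩ := saaD z hz1
        obtain ⟨h2, -, -⟩ := saDbD z hz2
        exact Complex.ext (by simp [haD, h1]) (by simp [haD, h2]))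
      (Set.disjoint_left.2 fun z hz1 hz2 => by
        have h1 := (saDbD z hz1).1
        have h2 := (hαim z hz2).1
        linarith)
      (Set.disjoint_left.2 fun z hz1 hz2 => by
        have h1 := (sbDb z hz1).1
        have h2 := (saaD z hz2).1
        linarith)
  -- the two curves in boxes
  have hrU' : ∀ z ∈ range γU, -1 ≤ z.re ∧ z.re ≤ 1 ∧ -1 ≤ z.im ∧ z.im ≤ 3 := by
    intro z hz
    rw [hrU] at hz
    rcases hz with ((hz | hz) | hz) | hz
    · exact ⟨(hαre z hz).1, (hαre z hz).2, (hαim z hz).1, by linarith [(hαim z hz).2]⟩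
    · obtain ⟨h1, h2, h3⟩ := sbbU z hz
      exact ⟨by rw [h1]; norm_num, h1.le, by linarith, h3⟩
    · obtain ⟨h1, h2, h3⟩ := sbUaU z hz
      exact ⟨h2, h3, by rw [h1]; norm_num, h1.le⟩
    · obtain ⟨h1, h2, h3⟩ := saUa z hz
      exact ⟨h1.ge, by rw [h1]; norm_num, by linarith, h3⟩
  have hrD' : ∀ z ∈ range γD, -1 ≤ z.re ∧ z.re ≤ 1 ∧ -3 ≤ z.im ∧ z.im ≤ 1 := by
    intro z hz
    rw [hrD] at hz
    rcases hz with ((hz | hz) | hz) | hz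
    · obtain ⟨h1, h2, h3⟩ := saDbD z hz
      exact ⟨h2, h3, h1.ge, by rw [h1]; norm_num⟩
    · obtain ⟨h1, h2, h3⟩ := sbDb z hz
      exact ⟨by rw [h1]; norm_num, h1.le, h2, by linarith⟩
    · exact ⟨(hαre z hz).1, (hαre z hz).2, by linarith [(hαim z hz).1], (hαim z hz).2⟩
    · obtain ⟨h1, h2, h3⟩ := saaD z hz
      exact ⟨h1.ge, by rw [h1]; norm_num, h2, by linarith⟩
  have hboxU : range γU ⊆ Icc (-1 : ℝ) 1 ×ℂ Icc (-1 : ℝ) 3 := fun z hz =>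
    ⟨⟨(hrU' z hz).1, (hrU' z hz).2.1⟩, (hrU' z hz).2.2.1, (hrU' z hz).2.2.2⟩
  have hboxD : range γD ⊆ Icc (-1 : ℝ) 1 ×ℂ Icc (-3 : ℝ) 1 := fun z hz =>
    ⟨⟨(hrD' z hz).1, (hrD' z hz).2.1⟩, (hrD' z hz).2.2.1, (hrD' z hz).2.2.2⟩
  have hclU := closure_ofLoop_subset_reProdIm hγU hpU hiU hboxU
  have hclD := closure_ofLoop_subset_reProdIm hγD hpD hiD hboxD
  have hopU := ofLoop_carrier_subset_reProdIm hγU hpU hiU hboxU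
  have hopD := ofLoop_carrier_subset_reProdIm hγD hpD hiD hboxD
  -- the closed domains meet along `α` only
  have hαγU : α ⊆ range γU := by rw [hrU]; exact fun z hz => Or.inl (Or.inl (Or.inl hz))
  have hαγD : α ⊆ range γD := by rw [hrD]; exact fun z hz => Or.inl (Or.inr hz)
  have hsep : QU.carrier ∩ QD.carrier ⊆ α := by
    rw [hcU, hcD]
    refine (closure_ofLoop_inter_closure_ofLoop_subset hγU hpU hiU hγD hpD hiD ?_ ?_
      (convex_halfSpace_im_lt (-1)).isPreconnected (not_isBounded_setOf_im_lt (-1)) ?_ ?_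
      (convex_halfSpace_im_gt 1).isPreconnected (not_isBounded_setOf_lt_im 1) ?_ ?_).trans ?_
    · -- the upper curve misses the lower domain
      refine Set.disjoint_left.2 fun z hz hzD => ?_
      obtain ⟨⟨h1, h2⟩, h3, h4⟩ := hopD hzD
      rw [hrU] at hz
      rcases hz with ((hz | hz) | hz) | hz
      · exact Set.disjoint_left.1 (disjoint_range_ofLoop_carrier hγD hpD hiD) (hαγD hz) hzD
      · have := (sbbU z hz).1; linarith
      · have := (sbUaU z hz).1; linarith
      · have := (saUa z hz).1; linarith
    · refine Set.disjoint_left.2 fun z hz hzU => ?_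
      obtain ⟨⟨h1, h2⟩, h3, h4⟩ := hopU hzU
      rw [hrD] at hz
      rcases hz with ((hz | hz) | hz) | hz
      · have := (saDbD z hz).1; linarith
      · have := (sbDb z hz).1; linarith
      · exact Set.disjoint_left.1 (disjoint_range_ofLoop_carrier hγU hpU hiU) (hαγU hz) hzU
      · have := (saaD z hz).1; linarith
    · exact Set.disjoint_left.2 fun z (hz : z.im < -1) hz' => by
        have := (hrU' z hz').2.2.1; linarith
    · -- inside points of the lower domain below height `-1`, near `-3i ∈ [aD, bD]`
      have hm : (⟨0, -3⟩ : ℂ) ∈ range γD := by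
        rw [hrD]
        refine Or.inl (Or.inl (Or.inl ?_))
        rw [mem_segment_iff_of_im_eq (p := aD) (q := bD) (by norm_num [haD, hbD])
          (by simp [haD, hbD])]
        norm_num [haD, hbD]
      obtain ⟨w, hwD, hw⟩ := exists_mem_ofLoop_carrier_dist_lt hγD hpD hiD hm one_pos
      refine ⟨w, ?_, hwD⟩
      show w.im < -1
      have h1 : |(w - ⟨0, -3⟩).im| ≤ ‖w - ⟨0, -3⟩‖ := Complex.abs_im_le_norm _
      rw [← dist_eq_norm, dist_comm] at h1
      have h2 : (w - ⟨0, -3⟩ : ℂ).im = w.im + 3 := by simp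
      rw [h2] at h1
      have h3 := (abs_le.1 (h1.trans hw.le)).2
      linarith
    · exact Set.disjoint_left.2 fun z (hz : 1 < z.im) hz' => by
        have := (hrD' z hz').2.2.2; linarith
    · have hm : (⟨0, 3⟩ : ℂ) ∈ range γU := by
        rw [hrU]
        refine Or.inl (Or.inr ?_)
        rw [segment_symm, mem_segment_iff_of_im_eq (p := aU) (q := bU) (by norm_num [haU, hbU])
          (by simp [haU, hbU])]
        norm_num [haU, hbU]
      obtain ⟨w, hwU, hw⟩ := exists_mem_ofLoop_carrier_dist_lt hγU hpU hiU hm one_pos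
      refine ⟨w, ?_, hwU⟩
      show 1 < w.im
      have h1 : |(w - ⟨0, 3⟩).im| ≤ ‖w - ⟨0, 3⟩‖ := Complex.abs_im_le_norm _
      rw [← dist_eq_norm, dist_comm] at h1
      have h2 : (w - ⟨0, 3⟩ : ℂ).im = w.im - 3 := by simp
      rw [h2] at h1
      have h3 := (abs_le.1 (h1.trans hw.le)).1
      linarith
    · -- the two curves meet along `α` only
      rintro z ⟨hzU, hzD⟩
      by_contra hzα
      rw [hrU] at hzU
      rw [hrD] at hzD
      have hzU' : z ∈ segment ℝ b bU ∨ z ∈ segment ℝ bU aU ∨ z ∈ segment ℝ aU a := by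
        rcases hzU with ((h | h) | h) | h
        exacts [(hzα h).elim, Or.inl h, Or.inr (Or.inl h), Or.inr (Or.inr h)]
      have hzD' : z ∈ segment ℝ aD bD ∨ z ∈ segment ℝ bD b ∨ z ∈ segment ℝ a aD := by
        rcases hzD with ((h | h) | h) | h
        exacts [Or.inl h, Or.inr (Or.inl h), (hzα h).elim, Or.inr (Or.inr h)]
      rcases hzU' with h | h | h
      · obtain ⟨h1, h2, h3⟩ := sbbU z h
        rcases hzD' with h' | h' | h'
        · have := (saDbD z h').1; linarith
        · have h4 := (sbDb z h').2.2
          exact hzα (by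
            rw [show z = b from Complex.ext (by rw [h1, hb]) (le_antisymm h4 h2)]; exact hbα)
        · have := (saaD z h').1; linarith
      · have h1 := (sbUaU z h).1
        have h2 := (hrD' z (by rw [hrD]; exact hzD)).2.2.2
        linarith
      · obtain ⟨h1, h2, h3⟩ := saUa z h
        rcases hzD' with h' | h' | h'
        · have := (saDbD z h').1; linarith
        · have := (sbDb z h').1; linarith
        · have h4 := (saaD z h').2.2
          exact hzα (by
            rw [show z = a from Complex.ext (by rw [h1, ha]) (le_antisymm h4 h2)]; exact haα)
  -- the two parametrisations of `α`
  set eU : I → ℂ := fun x => QU (x, 0) with heU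
  set eD : I → ℂ := fun x => QD (x, 1) with heD
  have hreU : range eU = α := by rw [heU, ← Quad.side_one_eq_range, hU1]
  have hreD : range eD = α := by rw [heD, ← Quad.side_three_eq_range, hD3]
  have heUc : Continuous eU := QU.continuous_toFun.comp (Continuous.prodMk_left 0)
  have heDc : Continuous eD := QD.continuous_toFun.comp (Continuous.prodMk_left 1)
  have heUi : Injective eU := fun x y h => by
    have := QU.injective_toFun h
    simpa using this
  have heDi : Injective eD := fun x y h => by
    have := QD.injective_toFun h
    simpa using this
  set fU : I → α := fun x => ⟨eU x, hreU ▸ mem_range_self x⟩ with hfU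
  set fD : I → α := fun x => ⟨eD x, hreD ▸ mem_range_self x⟩ with hfD
  have hfUb : Bijective fU := by
    refine ⟨fun x y h => heUi (congrArg Subtype.val h), fun ⟨z, hz⟩ => ?_⟩
    rw [← hreU] at hz
    obtain ⟨x, rfl⟩ := hz
    exact ⟨x, rfl⟩
  have hfDb : Bijective fD := by
    refine ⟨fun x y h => heDi (congrArg Subtype.val h), fun ⟨z, hz⟩ => ?_⟩
    rw [← hreD] at hz
    obtain ⟨x, rfl⟩ := hz
    exact ⟨x, rfl⟩
  set EU : I ≃ₜ α := Continuous.homeoOfEquivCompactToT2 (f := Equiv.ofBijective fU hfUb)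
    (heUc.subtype_mk _) with hEU
  set ED : I ≃ₜ α := Continuous.homeoOfEquivCompactToT2 (f := Equiv.ofBijective fD hfDb)
    (heDc.subtype_mk _) with hED
  set φ : I → I := fun x => ED.symm (EU x) with hφ
  have hφc : Continuous φ := ED.symm.continuous.comp EU.continuous
  have hφi : Injective φ := ED.symm.injective.comp EU.injective
  have hφe : ∀ x, eD (φ x) = eU x := fun x => by
    have h1 : ((ED (ED.symm (EU x)) : α) : ℂ) = (EU x : ℂ) := by rw [ED.apply_symm_apply]
    exact h1
  -- the corner values
  have heU0 : eU 0 = a := hαa _ (hreU ▸ mem_range_self 0) (by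
    have h := QU.apply_zero_mem_side_zero 0
    rw [hU0] at h
    exact (saUa _ h).1)
  have heU1 : eU 1 = b := hαb _ (hreU ▸ mem_range_self 1) (by
    have h := QU.apply_one_mem_side_two 0
    rw [hU2] at h
    exact (sbbU _ h).1)
  have heD0 : eD 0 = a := hαa _ (hreD ▸ mem_range_self 0) (by
    have h := QD.apply_zero_mem_side_zero 1
    rw [hD0] at h
    exact (saaD _ h).1)
  have heD1 : eD 1 = b := hαb _ (hreD ▸ mem_range_self 1) (by
    have h := QD.apply_one_mem_side_two 1
    rw [hD2] at h
    exact (sbDb _ h).1)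
  have hφ0 : φ 0 = 0 := heDi (by rw [hφe, heU0, heD0])
  have hφ1 : φ 1 = 1 := heDi (by rw [hφe, heU1, heD1])
  -- the reparametrised lower quad
  let QD' : Quad (univ : Set ℂ) :=
    { toFun := fun p => QD (φ p.1, p.2)
      continuous_toFun := QD.continuous_toFun.comp ((hφc.comp continuous_fst).prodMk continuous_snd)
      injective_toFun := fun p q h => by
        have h1 := QD.injective_toFun h
        simp only [Prod.mk.injEq] at h1
        exact Prod.ext (hφi h1.1) h1.2
      range_subset := subset_univ _ }
  have hQD'car : QD'.carrier ⊆ QD.carrier := by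
    rintro _ ⟨p, rfl⟩
    exact ⟨(φ p.1, p.2), rfl⟩
  refine ⟨QU, QD', fun x => (hφe x).symm, hreU, ?_, ?_, ?_, ?_, ?_, ?_, ?_⟩
  · rw [hU0]; exact fun z hz => (saUa z hz).1
  · rw [hU2]; exact fun z hz => (sbbU z hz).1
  · rintro _ ⟨p, hp, rfl⟩
    have hp' : p.1 = 0 := hp
    show (QD (φ p.1, p.2)).re = -1
    rw [hp', hφ0]
    have h := QD.apply_zero_mem_side_zero p.2
    rw [hD0] at h
    exact (saaD _ h).1
  · rintro _ ⟨p, hp, rfl⟩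
    have hp' : p.1 = 1 := hp
    show (QD (φ p.1, p.2)).re = 1
    rw [hp', hφ1]
    have h := QD.apply_one_mem_side_two p.2
    rw [hD2] at h
    exact (sbDb _ h).1
  · rw [hcU]
    exact fun z hz => ⟨(hclU hz).1.1, (hclU hz).1.2, (hclU hz).2.1⟩
  · exact fun z hz => by
      have hz' := hclD (hcD ▸ hQD'car hz)
      exact ⟨hz'.1.1, hz'.1.2, hz'.2.2⟩
  · exact fun z hz => hsep ⟨hz.1, hQD'car hz.2⟩

end QuadCrossing

end Literature.Probability.Percolation
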